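import Summits.CriticalPhenomena.PercolationContinuityZ3.Theorems.PercNearOneGluingNoHeavyLowerTailAntipodalR1ApexAdjacent
import HarnessLib

/-!
# The blob lemma for Reimer certificates (ANTI₁): closing a blob forces the target

Support file for `stmt-CriticalPhenomena-4575` (memo `prim-gen-kcluster/KCLUSTER-gen75.md` §1; conjecture
ANTI₁ of `KCLUSTER-gen52.md` §3).  No definitions, no named facts, no sorries.  Vocabulary of `AntipodalR1`
(`clus`, `lSet`, `rSet`, `tSet`) and the forcing lemma `AntipodalR1.cylinder_subset_rSet` (gen 74).

A *blob* for a point `x` of the left family `L` is a vertex set `D` with `a, c ∈ D`, `b ∉ D` such that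
(i) `D` is closed under the closed edges of `x` (a union of closed clusters), (ii) every vertex of `D`
adjacent to a vertex outside `D` lies in the closed cluster `K_a(x)` of the apex, and (iv) `a` is joined to
`b` by an open path none of whose edges has both ends in `D`.  Typical blobs: `K_a(x) ∪ Q_c(x) ∪ S` for any
union `S` of further components of `G − K_a(x)` (conditions (i), (ii) are then automatic), in particular
`V ∖ Q_b(x)` (the regional certificate of `…AntipodalR1Regional`) and `K_a(x) ∪ Q_c(x)`.

**Blob lemma** (`AntipodalR1.cylinder_subset_rSet_of_blob`).  Let `x₁, x₂ ∈ L` share a blob `D` and agree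
on every edge not inside `D`, and let `T_i` be the open edges of `x_i` inside `D`.  Then every point of
the cylinder `Z(x₁,x₂)` (equal to `x₁` off `T₁`, to `x̄₂` on `T₂`) lies in `R(b,c)`.  The two points may
have different — even incomparable — closed clusters of the apex; this is what makes blob classes
(key = the blob and the pattern outside it) usable as Reimer classes: hypothesis (F) of
`AntipodalR1.card_lSet_le_of_certificate` holds for every class whose members admit the class blob.
(Hypothesis (D) — disjointness across classes — is NOT automatic for blobs and is the subject of the
memo's §2; for the blob `V ∖ Q_b` it is, see `…AntipodalR1Regional`.)

Proof.  (F1) the path of (iv) consists of unflipped open edges.  (F2) an edge that is not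
determined-open is a closed edge of `x₁` or lies inside `D`; by (i) the closed cluster of `a` in any
cylinder point stays inside `D ∌ b`.  (F3) along the open `a–c` path of `x₂`, every
vertex of `D` is joined to `a` by determined-closed edges: a step inside `D` is a flipped open edge of
`x₂`, a step entering `D` from outside lands in `K_a(x₁)` by (ii) for `x₁`, and closed edges of `x₁` are
determined-closed.  (F4) from `a`, edges that are not determined-closed lead only to vertices outside `D`
or inside `K_a(x₂)`: such an edge is either not inside `D` (then an end in `D` is a boundary vertex, in
`K_a(x₂)` by (ii) for `x₂`) or a closed edge of `x₂` inside `D`; and `c ∈ D ∖ K_a(x₂)`.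
Census before formalisation (gen-75 `rulecheck.py`, rules `Dfull`, `Dstar2`, `maxblob*`): 0 bad cylinder
points on > 2.5·10⁶ left-family elements (all connected graphs `n ≤ 6`, multigraphs `n ≤ 6`, random
`n = 7, 8`). [this work]
-/

namespace Summit.CriticalPhenomena.PercolationContinuityZ3.Theorems

namespace AntipodalR1

open Finset Relation

variable {V ι : Type*} [Fintype ι] [DecidableEq ι]

section Blob

variable {ends : ι → Sym2 V} {a b c : V} {x₁ x₂ : ι → Bool} {T₁ T₂ : Finset ι} {D : Set V}

/-- (F1) and (F2) for a blob.  If `a ∈ D ∌ b`, `D` is closed under the closed edges of `x₁`, `T₁` only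
contains edges inside `D`, and `a` is joined to `b` by open edges of `x₁` not inside `D`, then the
determined-open indicator `dO` of the cylinder `Z(x₁,x₂)` has `b ∈ O_a(dO) ∖ K_a(dO)`. [this work] -/
theorem dO_mem_tSet_blob (haD : a ∈ D) (hbD : b ∉ D)
    (hDcl : ∀ e u w, ends e = s(u, w) → u ∈ D → x₁ e = false → w ∈ D)
    (hpath : ReflTransGen (fun u w => ∃ e, x₁ e = true ∧ ends e = s(u, w) ∧ ¬ (u ∈ D ∧ w ∈ D)) a b)
    (hT₁ : ∀ e ∈ T₁, ∀ u w, ends e = s(u, w) → u ∈ D ∧ w ∈ D) :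
    (fun e => (decide (e ∉ T₁) && x₁ e) || (decide (e ∈ T₂) && !x₂ e)) ∈ tSet ends a b := by
  classical
  set dO : ι → Bool := fun e => (decide (e ∉ T₁) && x₁ e) || (decide (e ∈ T₂) && !x₂ e) with hdO
  refine mem_filter.2 ⟨mem_univ _, ?_, ?_⟩
  · -- (F1)
    have key : ∀ v, ReflTransGen (fun u w => ∃ e, x₁ e = true ∧ ends e = s(u, w) ∧ ¬ (u ∈ D ∧ w ∈ D)) a v →
        ReflTransGen (fun u w => w ∈ nbr ends dO true u) a v := by
      intro v hv
      induction hv with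
      | refl => exact ReflTransGen.refl
      | @tail u w _ huw ih =>
        obtain ⟨e, hxe, hends, hnot⟩ := huw
        have heT : e ∉ T₁ := fun h => hnot (hT₁ e h u w hends)
        exact ReflTransGen.tail ih ⟨e, by simp [hdO, heT, hxe], hends⟩
    exact key b hpath
  · -- (F2): the `dO`-closed cluster of `a` stays inside `D`
    have key : ∀ v, ReflTransGen (fun u w => w ∈ nbr ends dO false u) a v → v ∈ D := by
      intro v hv
      induction hv with
      | refl => exact haD
      | @tail u w _ huw ih =>
        obtain ⟨e, hde, hends⟩ := huw
        by_cases heT : e ∈ T₁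
        · exact (hT₁ e heT u w hends).2
        · have hx₁e : x₁ e = false := by
            cases h : x₁ e
            · rfl
            · exfalso; have : dO e = true := by simp [hdO, heT, h]
              rw [hde] at this; exact Bool.false_ne_true this
          exact hDcl e u w hends ih hx₁e
    exact fun h => hbD (key b h)

/-- (F3) and (F4) for a blob.  If `x₁, x₂ ∈ L`, `c ∈ D`, every vertex of `D` adjacent to a vertex outside
`D` lies in `K_a(x₁)` and in `K_a(x₂)`, `T₁` contains only open edges of `x₁`, and `T₂` consists of the open
edges of `x₂` inside `D`, then the determined-closed indicator `dK` of the cylinder `Z(x₁,x₂)` has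
`c ∈ O_a(dK) ∖ K_a(dK)`. [this work] -/
theorem dK_mem_tSet_blob (hx₂ : x₂ ∈ lSet ends a b c) (hcD : c ∈ D)
    (hB₁ : ∀ e u w, ends e = s(u, w) → u ∈ D → w ∉ D → u ∈ clus ends x₁ false a)
    (hB₂ : ∀ e u w, ends e = s(u, w) → u ∈ D → w ∉ D → u ∈ clus ends x₂ false a)
    (hT₁ : ∀ e ∈ T₁, x₁ e = true)
    (hT₂ : ∀ e, e ∈ T₂ ↔ x₂ e = true ∧ ∀ u w, ends e = s(u, w) → u ∈ D ∧ w ∈ D) :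
    (fun e => (decide (e ∉ T₁) && !x₁ e) || (decide (e ∈ T₂) && x₂ e)) ∈ tSet ends a c := by
  classical
  obtain ⟨_, _, hOc₂, hKc₂, _⟩ := (mem_filter.1 hx₂).2
  set dK : ι → Bool := fun e => (decide (e ∉ T₁) && !x₁ e) || (decide (e ∈ T₂) && x₂ e) with hdK
  have hK₁ : clus ends x₁ false a ⊆ clus ends dK true a := by
    refine clus_mono₂ fun e he => ?_
    have : e ∉ T₁ := fun h => by have := hT₁ e h; rw [he] at this; exact Bool.false_ne_true this
    simp [hdK, this, he]
  have hT₂K : ∀ e ∈ T₂, dK e = true := fun e he => by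
    have := ((hT₂ e).1 he).1; simp [hdK, he, this]
  refine mem_filter.2 ⟨mem_univ _, ?_, ?_⟩
  · -- (F3): along the open `a–c` path of `x₂`, every vertex of `D` is `dK`-joined to `a`
    have key : ∀ v, ReflTransGen (fun u w => w ∈ nbr ends x₂ true u) a v →
        v ∈ D → v ∈ clus ends dK true a := by
      intro v hv
      induction hv with
      | refl => exact fun _ => ReflTransGen.refl
      | @tail u w _ huw ih =>
        intro hwD
        obtain ⟨e, hx₂e, hends⟩ := huw
        by_cases huD : u ∈ D
        · -- a step inside `D`: the edge is in `T₂`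
          have heT : e ∈ T₂ := (hT₂ e).2 ⟨hx₂e, fun u' w' he' => by
            rw [hends, Sym2.eq_iff] at he'
            rcases he' with ⟨rfl, rfl⟩ | ⟨rfl, rfl⟩
            · exact ⟨huD, hwD⟩
            · exact ⟨hwD, huD⟩⟩
          exact clus_step (ih huD) ⟨e, hT₂K e heT, hends⟩
        · -- a step entering `D`: `w` is a boundary vertex, hence in `K_a(x₁)`
          exact hK₁ (hB₁ e w u (by rw [hends, Sym2.eq_swap]) hwD huD)
    exact key c hOc₂ hcD
  · -- (F4): from `a`, non-`dK` edges lead outside `D` or into `K_a(x₂)`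
    have key : ∀ v, ReflTransGen (fun u w => w ∈ nbr ends dK false u) a v →
        v ∈ D → v ∈ clus ends x₂ false a := by
      intro v hv
      induction hv with
      | refl => exact fun _ => ReflTransGen.refl
      | @tail u w _ huw ih =>
        intro hwD
        obtain ⟨e, hde, hends⟩ := huw
        have heT₂ : ¬ (e ∈ T₂ ∧ x₂ e = true) := by
          rintro ⟨h1, h2⟩
          have : dK e = true := by simp [hdK, h1, h2]
          rw [hde] at this; exact Bool.false_ne_true this
        by_cases huD : u ∈ D
        · have hu : u ∈ clus ends x₂ false a := ih huD
          cases hx₂e : x₂ e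
          · exact clus_step hu ⟨e, hx₂e, hends⟩
          · -- open in `x₂` and inside `D`: it would be in `T₂`
            exfalso
            exact heT₂ ⟨(hT₂ e).2 ⟨hx₂e, fun u' w' he' => by
              rw [hends, Sym2.eq_iff] at he'
              rcases he' with ⟨rfl, rfl⟩ | ⟨rfl, rfl⟩
              · exact ⟨huD, hwD⟩
              · exact ⟨hwD, huD⟩⟩, hx₂e⟩
        · exact hB₂ e w u (by rw [hends, Sym2.eq_swap]) hwD huD
    exact fun h => hKc₂ (key c h hcD)

/-- **The blob lemma.**  Let `x₁, x₂ ∈ L = lSet ends a b c` and let `D` be a common blob: `a, c ∈ D`,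
`b ∉ D`; `D` closed under the closed edges of `x₁`; every vertex of `D` adjacent to the outside of `D` in
`K_a(x₁)` and in `K_a(x₂)`; `a` joined to `b` by open edges of `x₁` not inside `D`.  With `T_i` = the open
edges of `x_i` inside `D`, every point of the cylinder `Z(x₁,x₂)` lies in `R(b,c)`. [this work] -/
theorem cylinder_subset_rSet_of_blob (hx₂ : x₂ ∈ lSet ends a b c)
    (haD : a ∈ D) (hbD : b ∉ D) (hcD : c ∈ D)
    (hDcl : ∀ e u w, ends e = s(u, w) → u ∈ D → x₁ e = false → w ∈ D)
    (hB₁ : ∀ e u w, ends e = s(u, w) → u ∈ D → w ∉ D → u ∈ clus ends x₁ false a)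
    (hB₂ : ∀ e u w, ends e = s(u, w) → u ∈ D → w ∉ D → u ∈ clus ends x₂ false a)
    (hpath : ReflTransGen (fun u w => ∃ e, x₁ e = true ∧ ends e = s(u, w) ∧ ¬ (u ∈ D ∧ w ∈ D)) a b)
    (hT₁ : ∀ e, e ∈ T₁ ↔ x₁ e = true ∧ ∀ u w, ends e = s(u, w) → u ∈ D ∧ w ∈ D)
    (hT₂ : ∀ e, e ∈ T₂ ↔ x₂ e = true ∧ ∀ u w, ends e = s(u, w) → u ∈ D ∧ w ∈ D)
    {z : ι → Bool} (hz₁ : ∀ i, i ∉ T₁ → z i = x₁ i) (hz₂ : ∀ i ∈ T₂, z i = !x₂ i) :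
    z ∈ rSet ends a b c :=
  cylinder_subset_rSet ends a b c x₁ x₂ T₁ T₂
    (dO_mem_tSet_blob haD hbD hDcl hpath (fun e he => ((hT₁ e).1 he).2))
    (dK_mem_tSet_blob hx₂ hcD hB₁ hB₂ (fun e he => ((hT₁ e).1 he).1) hT₂) hz₁ hz₂

end Blob

end AntipodalR1

end Summit.CriticalPhenomena.PercolationContinuityZ3.Theorems
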